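import Summits.BirchSwinnertonDyer.BirchSwinnertonDyer.Theorems.EisensteinPrimesCharResidualSelmerKummer
import HarnessLib

/-!
# Kummer at the `U`-level: `H¹(K_Σ/K_∞, A[p]) ≅ H¹(K_Σ/K_∞, A)[p]` in the tree's currency
# `unramifiedOutside H (A[p]) p S₀ ≅ (unramifiedOutside H A p S₀)[p]` — GENERIC in the module, with the
# character `(F/𝒪)(θ)` and the «inertia acts trivially at good places» (curve) instances
# (cell `bsd-eis`, seat `bsd-line-x1-p1-w4` gen 3, D-0154 WIDTH PASS; crux 2 `GoodLatticeBDPValue`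
# stmt-BirchSwinnertonDyer-19032, line `halves` v19.1, V21 INDEX ROAD step (2) `0 → A^G/p → H¹(G,N) → U(A)[p] → 0`)

HONEST FRAMING (cell `bsd-eis`, run/shared/lean/pub/bsd-eis/): Galois-cohomology bookkeeping on constructed
objects; no definition, no named fact, no `sorry`, no `Theses` import; nothing about any curve is asserted;
BSD / IMC2 / KY Thm. 1.4.1 are proved for NO curve. Helper `--supports stmt-BirchSwinnertonDyer-19032`.

## Why
Step (2) of LEAD g4's index road (`Cruxes/GoodLatticeBDPValue/Lines/halves-imprimLambda-index-road.md`) is the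
Kummer sequence `0 → A^G/p → H¹(G, N) → U(A)[p] → 0` for `G = Gal(K_Σ/K_∞)`, `N = A[p]`, `U(A) = H¹(G, A)` =
the classes of `H¹(Gal(K̄/K_∞), A)` unramified outside `Σ = S₀ ∪ {p}` = the tree's
`GreenbergVatsal2000.unramifiedOutside H A p S₀` (`H = ker κ`). For all three modules of the road
(`A_ω = (F/𝒪)(θsub)`, `A_1 = (F/𝒪)(θquot)`, `A_f = E[p^∞]`) one has `A^G/p = 0`, so step (2) at the `U`-level
is a BIJECTION `U(N) ≅ U(A)[p]`. This file proves it ONCE, for an abstract `j : N ↪ A` equivariant onto `A[p]`,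
from three hypotheses: `A` is `p`-divisible with continuous `Γ_K`-orbits (surjectivity onto `U(A)[p]`, brick
`exists_resH1Hom_id_eq_of_nsmul_eq_zero` of p639745); `A^H` is `p`-divisible inside itself (injectivity on
`H¹(H, ·)`); and at every `w ∉ S₀`, `w ∤ p`, `A^{H ⊓ I_w}` is `p`-divisible inside itself (the unramified
condition REFLECTS along `j_*`: injectivity on `H¹(H ⊓ I_w, ·)`, brick `resH1Hom_id_injective_of_invariants_divisible`).

* §1 `mem_unramifiedKer_iff_of_invariants_divisible` (one place), `mem_unramifiedOutside_iff_resH1Hom_id_mem`,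
  **`natCard_unramifiedOutside_eq_natCard_pTorsion`** (the bijection as a count; `Nat.card`).
* §2 instances: the CHARACTER `(F/𝒪)(θ)`, `θ^{p−1} = 1` — every hypothesis is free
  (`charModule_invariants_divisible`, `charModule_divisible`, `continuous_smul_charModule`):
  **`natCard_unramifiedOutside_residual_char_eq`**; and the «TRIVIAL INERTIA ACTION at the good places +
  no `H`-fixed points» shape (`natCard_unramifiedOutside_eq_of_inertia_trivial`), which the `E[p^∞]` consumer
  instantiates with Néron–Ogg–Shafarevich at `w ∉ S₀ ⊇ {bad}` and `E(K_∞)[p^∞] = 0`.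

NOT here: the local (`P`-level) Kummer sequences at the places above `v̄`, whose kernels `A^{G_j}/p` are the
`δ_j` of step (5) (w2 gen 3's `AnomalousLocalTorsion`, UTD `LocalKummerKernel`).

References: [KellerYin2024] Lemma 1.2.4 and (2) of §1.4 (arXiv:2402.12781v2 TeX L760–778, L1100–1120);
[SerreGaloisCohomology1997] I.§2.2 (Prop. 2); [GreenbergVatsal2000] §2 pp. 16–17, 23; [NeukirchSchmidtWingberg2008] (8.3.x) (`H¹(G_Σ, ·)` as unramified classes).
-/

set_option autoImplicit false
set_option linter.dupNamespace false -- the summit namespace `…BirchSwinnertonDyer.BirchSwinnertonDyer.Theorems` (Sub = Summit, D-0017) trips it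

noncomputable section

open scoped Classical

namespace Summit.BirchSwinnertonDyer.BirchSwinnertonDyer.Theorems.CharResidualSelmerCount

open NumberField IsDedekindDomain Field
open Literature.NumberTheory.EllipticCurves Literature.NumberTheory.EllipticCurves.GreenbergSelmer
  Literature.NumberTheory.EllipticCurves.GreenbergVatsal2000 Literature.NumberTheory.GaloisRepresentations
  Literature.NumberTheory.EllipticCurves.KellerYin2024 Literature.NumberTheory.EllipticCurves.FineSelmerCoefficientMap
  Summit.BirchSwinnertonDyer.BirchSwinnertonDyer.Theorems.CharResidualSelmerFinite
  Summit.BirchSwinnertonDyer.BirchSwinnertonDyer.Theorems.UniversalToricDescentResidualSelmer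

/-! ### §1 Generic: `U(N) ≅ U(A)[p]` for `j : N ↪ A` onto `A[p]` -/

section Generic

variable {K : Type} [Field K] [NumberField K] {p : ℕ}
  (H : Subgroup (absoluteGaloisGroup K)) (S₀ : Set (HeightOneSpectrum (𝓞 K)))
  {A : Type} [AddCommGroup A] [DistribMulAction (absoluteGaloisGroup K) A] [TopologicalSpace A]
  [DiscreteTopology A]
  {B : Type} [AddCommGroup B] [DistribMulAction (absoluteGaloisGroup K) B] [TopologicalSpace B]
  [DiscreteTopology B]

/-- **The unramified condition at `v` reflects along `j_*` when `B^{H ⊓ I_v}` is `p`-divisible in itself**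
(`j : A ↪ B` equivariant onto `B[p]`): then `j_*` is injective on `H¹(H ⊓ I_v, ·)`
(`resH1Hom_id_injective_of_invariants_divisible`) and commutes with restriction to the inertia group.
[cite: SerreGaloisCohomology1997, I.§2.2 (Prop. 2)] [cite: GreenbergVatsal2000, §2 p. 17] -/
theorem mem_unramifiedKer_iff_of_invariants_divisible (v : HeightOneSpectrum (𝓞 K)) (j : A →+ B)
    (hj : ∀ (σ : absoluteGaloisGroup K) (a : A), j (σ • a) = σ • j a) (hinj : Function.Injective j)
    (hrange : ∀ x : B, x ∈ j.range ↔ p • x = 0)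
    (hinv : ∀ b : B, (∀ g : absoluteGaloisGroup K, g ∈ H → g ∈ inertia v → g • b = b) →
      ∃ b' : B, (∀ g : absoluteGaloisGroup K, g ∈ H → g ∈ inertia v → g • b' = b') ∧ p • b' = b)
    (c : subgroupH1 H A) :
    c ∈ unramifiedKer H A v ↔
      resH1Hom (ContinuousMonoidHom.id H) j (fun g a ↦ hj (g : absoluteGaloisGroup K) a) c ∈
        unramifiedKer H B v := by
  refine ⟨fun hc ↦ resH1Hom_id_mem_unramifiedKer H v j hj _ hc, fun hc ↦ ?_⟩
  -- `B^{inertiaIn H v}` is `p`-divisible in itself, in the `inertiaIn` currency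
  have hinv' : ∀ b : B, (∀ g : inertiaIn H v, g • b = b) →
      ∃ b' : B, (∀ g : inertiaIn H v, g • b' = b') ∧ p • b' = b := by
    intro b hb
    obtain ⟨b', hb', hpb'⟩ := hinv b (fun g hgH hgI ↦
      hb ⟨⟨g, inertia_le_decomp v hgI⟩, (mem_inertiaIn_iff H v _).2 ⟨hgH, hgI⟩⟩)
    exact ⟨b', fun g ↦ hb' _ ((mem_inertiaIn_iff H v _).1 g.2).1 ((mem_inertiaIn_iff H v _).1 g.2).2, hpb'⟩
  have hinjI := resH1Hom_id_injective_of_invariants_divisible (G := inertiaIn H v) j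
    (fun x a ↦ hj ((x : decomp (K := K) v) : absoluteGaloisGroup K) a) hinj hrange hinv'
  rw [GreenbergVatsal2000.unramifiedKer, AddMonoidHom.mem_ker] at hc ⊢
  have e := congrArg (fun f ↦ f c) (res_inertiaIn_comp_resH1Hom_id H v j
    (fun g a ↦ hj (g : absoluteGaloisGroup K) a)
    (fun x a ↦ hj ((x : decomp (K := K) v) : absoluteGaloisGroup K) a))
  simp only [AddMonoidHom.comp_apply] at e
  rw [e] at hc
  exact (injective_iff_map_eq_zero _).mp hinjI _ hc

variable [H.Normal]

/-- **`c ∈ U(A) ↔ j_* c ∈ U(B)`** (`U = unramifiedOutside H · p S₀`): every defining condition "a conjugate is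
unramified at `w ∉ S₀`, `w ∤ p`" reflects along `j_*` (previous lemma; `j_*` commutes with the conjugations).
[cite: GreenbergVatsal2000, §2 pp. 16, 23] [cite: KellerYin2024, Lemma 1.2.4 (arXiv:2402.12781v2 TeX L760–778)] -/
theorem mem_unramifiedOutside_iff_resH1Hom_id_mem (j : A →+ B)
    (hj : ∀ (σ : absoluteGaloisGroup K) (a : A), j (σ • a) = σ • j a) (hinj : Function.Injective j)
    (hrange : ∀ x : B, x ∈ j.range ↔ p • x = 0)
    (hinvI : ∀ v : HeightOneSpectrum (𝓞 K), v ∉ S₀ → ((p : ℕ) : 𝓞 K) ∉ v.asIdeal →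
      ∀ b : B, (∀ g : absoluteGaloisGroup K, g ∈ H → g ∈ inertia v → g • b = b) →
        ∃ b' : B, (∀ g : absoluteGaloisGroup K, g ∈ H → g ∈ inertia v → g • b' = b') ∧ p • b' = b)
    (c : subgroupH1 H A) :
    c ∈ unramifiedOutside H A p S₀ ↔
      resH1Hom (ContinuousMonoidHom.id H) j (fun g a ↦ hj (g : absoluteGaloisGroup K) a) c ∈
        unramifiedOutside H B p S₀ := by
  have hconj : ∀ σ : absoluteGaloisGroup K,
      conjH1 H B σ (resH1Hom (ContinuousMonoidHom.id H) j (fun g a ↦ hj (g : absoluteGaloisGroup K) a) c) =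
        resH1Hom (ContinuousMonoidHom.id H) j (fun g a ↦ hj (g : absoluteGaloisGroup K) a) (conjH1 H A σ c) :=
    fun σ ↦ congrArg (fun f ↦ f c) (conjH1_comp_resH1Hom_id H j
      (fun g a ↦ hj (g : absoluteGaloisGroup K) a) hj σ)
  rw [mem_unramifiedOutside_iff, mem_unramifiedOutside_iff]
  refine ⟨fun h v hv hpv σ ↦ ?_, fun h v hv hpv σ ↦ ?_⟩
  · rw [hconj]
    exact (mem_unramifiedKer_iff_of_invariants_divisible H v j hj hinj hrange (hinvI v hv hpv) _).mp
      (h v hv hpv σ)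
  · have h' := h v hv hpv σ
    rw [hconj] at h'
    exact (mem_unramifiedKer_iff_of_invariants_divisible H v j hj hinj hrange (hinvI v hv hpv) _).mpr h'

/-- **KUMMER AT THE `U`-LEVEL: `#U(A) = #U(B)[p]`**, i.e. `j_*` is a bijection from
`unramifiedOutside H A p S₀` onto the `p`-torsion of `unramifiedOutside H B p S₀`, for `j : A ↪ B` equivariant
onto `B[p]` with `B` `p`-divisible (continuous `Γ_K`-orbits), `B^H` `p`-divisible in itself and `B^{H ⊓ I_w}`
`p`-divisible in itself at every `w ∉ S₀`, `w ∤ p`. Injective: `resH1Hom_id_injective_of_invariants_divisible`;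
onto: `exists_resH1Hom_id_eq_of_nsmul_eq_zero` + condition reflection; `pA = 0` makes every class of `H¹(H, A)`
`p`-torsion. V21 step (2) with `A^G/p = 0`: `H¹(G, N) ≅ U(A)[p]`. (`Nat.card`; both sides `0` if infinite.)
[cite: KellerYin2024, §1.4 (2) and Lemma 1.2.4 (arXiv:2402.12781v2)] [cite: SerreGaloisCohomology1997, I.§2.2 (Prop. 2)] -/
theorem natCard_unramifiedOutside_eq_natCard_pTorsion (j : A →+ B)
    (hj : ∀ (σ : absoluteGaloisGroup K) (a : A), j (σ • a) = σ • j a) (hinj : Function.Injective j)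
    (hrange : ∀ x : B, x ∈ j.range ↔ p • x = 0)
    (hcont : ∀ b : B, Continuous fun g : absoluteGaloisGroup K ↦ g • b)
    (hdiv : ∀ b : B, ∃ b' : B, p • b' = b)
    (hinvH : ∀ b : B, (∀ g : absoluteGaloisGroup K, g ∈ H → g • b = b) →
      ∃ b' : B, (∀ g : absoluteGaloisGroup K, g ∈ H → g • b' = b') ∧ p • b' = b)
    (hinvI : ∀ v : HeightOneSpectrum (𝓞 K), v ∉ S₀ → ((p : ℕ) : 𝓞 K) ∉ v.asIdeal →
      ∀ b : B, (∀ g : absoluteGaloisGroup K, g ∈ H → g ∈ inertia v → g • b = b) →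
        ∃ b' : B, (∀ g : absoluteGaloisGroup K, g ∈ H → g ∈ inertia v → g • b' = b') ∧ p • b' = b) :
    Nat.card (unramifiedOutside H A p S₀) =
      Nat.card {s : unramifiedOutside H B p S₀ // p • s = 0} := by
  let jH := resH1Hom (ContinuousMonoidHom.id H) j (fun g a ↦ hj (g : absoluteGaloisGroup K) a)
  -- injectivity on `H¹(H, ·)`
  have hinvH' : ∀ b : B, (∀ g : H, g • b = b) → ∃ b' : B, (∀ g : H, g • b' = b') ∧ p • b' = b := by
    intro b hb
    obtain ⟨b', hb', hpb'⟩ := hinvH b (fun g hg ↦ hb ⟨g, hg⟩)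
    exact ⟨b', fun g ↦ hb' g g.2, hpb'⟩
  have hinjH : Function.Injective jH :=
    resH1Hom_id_injective_of_invariants_divisible (G := H) j _ hinj hrange hinvH'
  -- every class of `H¹(H, A)` is `p`-torsion
  have hpA : ∀ a : A, p • a = 0 := fun a ↦ hinj (by
    rw [map_nsmul, map_zero]; exact (hrange (j a)).mp ⟨a, rfl⟩)
  have hpc : ∀ c : subgroupH1 H A, p • c = 0 := nsmul_discreteH1_eq_zero (G := H) hpA
  let F : unramifiedOutside H A p S₀ → {s : unramifiedOutside H B p S₀ // p • s = 0} :=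
    fun c ↦ ⟨⟨jH c, (mem_unramifiedOutside_iff_resH1Hom_id_mem H S₀ j hj hinj hrange hinvI _).mp c.2⟩,
      Subtype.ext (by
        change p • jH c = 0
        rw [← map_nsmul, hpc, map_zero])⟩
  refine Nat.card_eq_of_bijective F ⟨fun c c' h ↦ ?_, fun s ↦ ?_⟩
  · have h' : jH c = jH c' := congrArg (fun s ↦ ((s.1 : unramifiedOutside H B p S₀) : subgroupH1 H B)) h
    exact Subtype.ext (hinjH h')
  · have hs : p • ((s.1 : unramifiedOutside H B p S₀) : subgroupH1 H B) = 0 := by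
      rw [← AddSubgroupClass.coe_nsmul, s.2]; rfl
    obtain ⟨c, hc⟩ := exists_resH1Hom_id_eq_of_nsmul_eq_zero (G := H) j
      (fun g a ↦ hj (g : absoluteGaloisGroup K) a) hinj hrange
      (fun b ↦ (hcont b).comp continuous_subtype_val) hdiv _ hs
    have hcmem : c ∈ unramifiedOutside H A p S₀ := by
      rw [mem_unramifiedOutside_iff_resH1Hom_id_mem H S₀ j hj hinj hrange hinvI, hc]
      exact s.1.2
    exact ⟨⟨c, hcmem⟩, Subtype.ext (Subtype.ext hc)⟩

/-- **The same in the shape «no non-zero `H`-fixed point, inertia acts TRIVIALLY at the good places»**: if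
`B^H = 0` and every `I_w`, `w ∉ S₀`, `w ∤ p`, acts trivially on `B` (so `B^{H ⊓ I_w} = B`, divisible), then
`#U(A) = #U(B)[p]`. This is the form the curve consumer meets: `B = E[p^∞]` with `E(K_∞)[p^∞] = 0` and
Néron–Ogg–Shafarevich at the good `w ∉ S₀`. [cite: KellerYin2024, §1.4 (2) (arXiv:2402.12781v2)]
[cite: SerreGaloisCohomology1997, I.§2.2 (Prop. 2)] -/
theorem natCard_unramifiedOutside_eq_of_inertia_trivial (j : A →+ B)
    (hj : ∀ (σ : absoluteGaloisGroup K) (a : A), j (σ • a) = σ • j a) (hinj : Function.Injective j)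
    (hrange : ∀ x : B, x ∈ j.range ↔ p • x = 0)
    (hcont : ∀ b : B, Continuous fun g : absoluteGaloisGroup K ↦ g • b)
    (hdiv : ∀ b : B, ∃ b' : B, p • b' = b)
    (hfix : ∀ b : B, (∀ g : absoluteGaloisGroup K, g ∈ H → g • b = b) → b = 0)
    (htriv : ∀ v : HeightOneSpectrum (𝓞 K), v ∉ S₀ → ((p : ℕ) : 𝓞 K) ∉ v.asIdeal →
      ∀ g : absoluteGaloisGroup K, g ∈ inertia v → ∀ b : B, g • b = b) :
    Nat.card (unramifiedOutside H A p S₀) =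
      Nat.card {s : unramifiedOutside H B p S₀ // p • s = 0} := by
  refine natCard_unramifiedOutside_eq_natCard_pTorsion H S₀ j hj hinj hrange hcont hdiv ?_ ?_
  · intro b hb
    exact ⟨0, fun g _ ↦ smul_zero g, by rw [hfix b hb, smul_zero]⟩
  · intro v hv hpv b _
    obtain ⟨b', hb'⟩ := hdiv b
    exact ⟨b', fun g _ hgI ↦ htriv v hv hpv g hgI b', hb'⟩

end Generic

/-! ### §2 The character `(F/𝒪)(θ)`: every hypothesis is free -/

section Character

variable {K : Type} [Field K] [NumberField K] {p : ℕ} [hp : Fact p.Prime]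
  (θ : FramedGaloisRep K (padicCoeffIntegers (∅ : Set (PadicAlgCl p))) 1)
  (H : Subgroup (absoluteGaloisGroup K)) [H.Normal] (S₀ : Set (HeightOneSpectrum (𝓞 K)))
  {A : Type} [AddCommGroup A] [DistribMulAction (absoluteGaloisGroup K) A] [TopologicalSpace A]
  [DiscreteTopology A]

/-- **`#U(𝔽(θ̄)) = #U((F/𝒪)(θ))[p]`** — Kummer at the `U`-level for a character: `A ↪ (F/𝒪)(θ)` equivariant onto
the `p`-torsion, `θ^{p−1} = 1`, any normal `H ≤ Γ_K`, any `S₀` (no proviso on the ramification of `θ`: under every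
subgroup the invariants of `(F/𝒪)(θ)` are all or nothing, `charModule_invariants_divisible`). V21 step (2) for
`A_ω`, `A_1`: `H¹(G, N_θ) ≅ U(A_θ)[p]`. [cite: KellerYin2024, Lemma 1.2.4 and §1.4 (2) (arXiv:2402.12781v2 TeX L760–778)]
[cite: CastellaGrossiLeeSkinner2022, Lemma 13 (arXiv:2008.02571 §1.2)] -/
theorem natCard_unramifiedOutside_residual_char_eq
    (hθ : ∀ σ : absoluteGaloisGroup K, θ σ ^ (p - 1) = 1)
    (j : A →+ charModule (∅ : Set (PadicAlgCl p)) θ)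
    (hj : ∀ (σ : absoluteGaloisGroup K) (a : A), j (σ • a) = σ • j a) (hinj : Function.Injective j)
    (hrange : ∀ x : charModule (∅ : Set (PadicAlgCl p)) θ, x ∈ j.range ↔ p • x = 0) :
    Nat.card (unramifiedOutside H A p S₀) =
      Nat.card {s : unramifiedOutside H (charModule (∅ : Set (PadicAlgCl p)) θ) p S₀ // p • s = 0} := by
  refine natCard_unramifiedOutside_eq_natCard_pTorsion H S₀ j hj hinj hrange (continuous_smul_charModule θ)
    (charModule_divisible θ) ?_ ?_
  · intro b hb
    obtain ⟨b', hb', hpb'⟩ := charModule_invariants_divisible θ hθ (G := H) (fun g ↦ (g : absoluteGaloisGroup K))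
      (fun _ _ ↦ rfl) b (fun g ↦ hb g g.2)
    exact ⟨b', fun g hg ↦ hb' ⟨g, hg⟩, hpb'⟩
  · intro v _ _ b hb
    obtain ⟨b', hb', hpb'⟩ := charModule_invariants_divisible θ hθ (G := ↥(H ⊓ inertia v))
      (fun g ↦ (g : absoluteGaloisGroup K)) (fun _ _ ↦ rfl) b
      (fun g ↦ hb g (Subgroup.mem_inf.mp g.2).1 (Subgroup.mem_inf.mp g.2).2)
    exact ⟨b', fun g hgH hgI ↦ hb' ⟨g, Subgroup.mem_inf.mpr ⟨hgH, hgI⟩⟩, hpb'⟩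

/-- The membership form for the character: `c ∈ U(A) ↔ j_* c ∈ U((F/𝒪)(θ))`.
[cite: KellerYin2024, Lemma 1.2.4 (arXiv:2402.12781v2 TeX L760–778)] -/
theorem mem_unramifiedOutside_iff_resH1Hom_id_mem_char
    (hθ : ∀ σ : absoluteGaloisGroup K, θ σ ^ (p - 1) = 1)
    (j : A →+ charModule (∅ : Set (PadicAlgCl p)) θ)
    (hj : ∀ (σ : absoluteGaloisGroup K) (a : A), j (σ • a) = σ • j a) (hinj : Function.Injective j)
    (hrange : ∀ x : charModule (∅ : Set (PadicAlgCl p)) θ, x ∈ j.range ↔ p • x = 0)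
    (c : subgroupH1 H A) :
    c ∈ unramifiedOutside H A p S₀ ↔
      resH1Hom (ContinuousMonoidHom.id H) j (fun g a ↦ hj (g : absoluteGaloisGroup K) a) c ∈
        unramifiedOutside H (charModule (∅ : Set (PadicAlgCl p)) θ) p S₀ := by
  refine mem_unramifiedOutside_iff_resH1Hom_id_mem H S₀ j hj hinj hrange ?_ c
  intro v _ _ b hb
  obtain ⟨b', hb', hpb'⟩ := charModule_invariants_divisible θ hθ (G := ↥(H ⊓ inertia v))
    (fun g ↦ (g : absoluteGaloisGroup K)) (fun _ _ ↦ rfl) b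
    (fun g ↦ hb g (Subgroup.mem_inf.mp g.2).1 (Subgroup.mem_inf.mp g.2).2)
  exact ⟨b', fun g hgH hgI ↦ hb' ⟨g, Subgroup.mem_inf.mpr ⟨hgH, hgI⟩⟩, hpb'⟩

end Character

end Summit.BirchSwinnertonDyer.BirchSwinnertonDyer.Theorems.CharResidualSelmerCount

end
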